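import Summits.QuantumFields.YangMills.Theorems.BalabanLadderIRcofEquipartitionSeamSliceKernelSeamTransport
import Summits.QuantumFields.YangMills.Theorems.BalabanLadderIRcofEquipartitionSeamSpectralDict
import Summits.QuantumFields.YangMills.Theorems.BalabanLadderIRcofEquipartitionSeamSpectralDictRealPosType
import Summits.QuantumFields.YangMills.Theorems.BalabanLadderIRcofEquipartitionSeamSpectralDictKernelCalc
import Literature.Analysis.OperatorTheory.HeterogeneousCyclicPeeling
import HarnessLib

/-!
# Crux `IRcof` (stmt-QuantumFields-26930) · line `equipartition_seam` (row 47) · located stub **L `SpectralDict.SliceRealisationV`** —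
# PART 1 ∕ 4 — the BLOCK KERNEL of a windowed species: index bookkeeping on `Fin ((M+3)+(r+2))`, `padV` ∕ `padE`, the named splitting `finSplit`, `blockKernel` with `stronglyMeasurable_uncurry_blockKernel` ∕ `norm_blockKernel_le` ∕ `abs_blockKernel_le_pathK` (= L's `|Bk| ≤ nrm A · pathK μ K rB`)

SOURCE OF RECORD: `Cruxes/IRcof/Lines/equipartition_seam_SliceRealisation.lean` rev 1 (crux write 0079346b2e66, 1445 l., 77 decls; author ideator ym-ir-idea-22 g8; LAND-ASK «stub L» bus l.≈1828; critic ym-ir-crit-3 g6 TYPEREAD asked there) — cut VERBATIM at its `PART k` banners into ≤ 400-line Theorems files by LEAD prover ym-ir-line-ab-p1 g8, each importing the previous; the author's `set_option maxHeartbeats 400000 in` lines (six, pre-budgeted per ops-buildfix-2) are kept verbatim.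

HONEST FRAMING.  Finite-box Fubini ∕ Haar bookkeeping (the transfer-operator REALISATION of the split-weight sector functions); it closes the LOCATED typing stub L `SpectralDict.SliceRealisationV` of row 47 only in PART 4 and proves NO constructive-QFT estimate: the located stubs S1 · S3ʷ · T · N · S5ᵛ stay open; row 47 class PWP, mechanism 0, width 0; `IRcof` ∕ `IR` 0∕1; the Yang–Mills mass gap (Clay) is NOT proved by anything in this tree; R4 closes only the conditional finite-𝕋⁴ rung `BalabanLadder.UV`.
-/

noncomputable section

open MeasureTheory ProbabilityTheory Finset Filter Function
open scoped BigOperators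

namespace Summit.QuantumFields.YangMills.Cruxes.IRcof.EquipartitionSeam.SliceKernel

open Literature.MathematicalPhysics.QuantumFieldTheory (haarProbability)
open Literature.Analysis.OperatorTheory (measurePreserving_finSplit finSplit_apply_fst finSplit_apply_snd
  integral_pi_comp_perm)
open Summit.QuantumFields.YangMills.Cruxes.IRcof.EquipartitionSeam.SpectralDict (pathK)

/-! ## PART 1 — the block kernel of a windowed species -/

/-! ### Index bookkeeping on `Fin ((M + 3) + (r + 2))` -/

section Index

/-- `((finRotate m t) : ℕ) = (t + 1) % m` (`private`: the same statement is `Literature.Probability.RandomPlanarGeometry.val_finRotate_eq_mod`, gate dedup.landed; kept local to avoid importing an unrelated, possibly unbuilt module). -/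
private theorem val_finRotate {m : ℕ} (t : Fin m) : ((finRotate m t : Fin m) : ℕ) = ((t : ℕ) + 1) % m := by
  cases m with
  | zero => exact t.elim0
  | succ n =>
    rw [finRotate_apply, Fin.val_add, Fin.val_one', Nat.add_mod_mod]

variable (M r : ℕ)

/-- Auxiliary `finRotate_castAdd_castSucc` of the slice-realisation port (its statement is its type; rôle explained in the module ∕ section docstrings). -/
theorem finRotate_castAdd_castSucc (j : Fin (M + 2)) :
    finRotate ((M + 3) + (r + 2)) (Fin.castAdd (r + 2) (Fin.castSucc j)) = Fin.castAdd (r + 2) j.succ := by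
  apply Fin.ext
  rw [val_finRotate]
  simp only [Fin.val_castAdd, Fin.val_castSucc, Fin.val_succ]
  exact Nat.mod_eq_of_lt (by omega)

/-- Auxiliary `finRotate_castAdd_last` of the slice-realisation port (its statement is its type; rôle explained in the module ∕ section docstrings). -/
theorem finRotate_castAdd_last :
    finRotate ((M + 3) + (r + 2)) (Fin.castAdd (r + 2) (Fin.last (M + 2))) = Fin.natAdd (M + 3) 0 := by
  apply Fin.ext
  rw [val_finRotate]
  simp only [Fin.val_castAdd, Fin.val_last, Fin.val_natAdd, Fin.val_zero, add_zero]
  exact Nat.mod_eq_of_lt (by omega)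

/-- Auxiliary `finRotate_natAdd_castSucc` of the slice-realisation port (its statement is its type; rôle explained in the module ∕ section docstrings). -/
theorem finRotate_natAdd_castSucc (b : Fin (r + 1)) :
    finRotate ((M + 3) + (r + 2)) (Fin.natAdd (M + 3) (Fin.castSucc b)) = Fin.natAdd (M + 3) b.succ := by
  apply Fin.ext
  rw [val_finRotate]
  simp only [Fin.val_natAdd, Fin.val_castSucc, Fin.val_succ]
  rw [Nat.mod_eq_of_lt (by omega)]
  omega

/-- Auxiliary `finRotate_natAdd_last` of the slice-realisation port (its statement is its type; rôle explained in the module ∕ section docstrings). -/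
theorem finRotate_natAdd_last :
    finRotate ((M + 3) + (r + 2)) (Fin.natAdd (M + 3) (Fin.last (r + 1))) = Fin.castAdd (r + 2) 0 := by
  apply Fin.ext
  rw [val_finRotate]
  simp only [Fin.val_natAdd, Fin.val_last, Fin.val_castAdd, Fin.val_zero]
  rw [show M + 3 + (r + 1) + 1 = (M + 3) + (r + 2) by omega, Nat.mod_self]

/-- Auxiliary `castAdd_ne_natAdd_last` of the slice-realisation port (its statement is its type; rôle explained in the module ∕ section docstrings). -/
theorem castAdd_ne_natAdd_last (j : Fin (M + 3)) :
    Fin.castAdd (r + 2) j ≠ Fin.natAdd (M + 3) (Fin.last (r + 1)) := by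
  intro h
  have := congrArg Fin.val h
  simp only [Fin.val_castAdd, Fin.val_natAdd, Fin.val_last] at this
  omega

/-- Auxiliary `natAdd_castSucc_ne_natAdd_last` of the slice-realisation port (its statement is its type; rôle explained in the module ∕ section docstrings). -/
theorem natAdd_castSucc_ne_natAdd_last (b : Fin (r + 1)) :
    Fin.natAdd (M + 3) (Fin.castSucc b) ≠ Fin.natAdd (M + 3) (Fin.last (r + 1)) := by
  intro h
  have := congrArg Fin.val h
  simp only [Fin.val_natAdd, Fin.val_castSucc, Fin.val_last] at this
  omega

/-- `Fin.cons (W 0) (Fin.snoc (middle of W) (W last)) = W`. -/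
theorem cons_snoc_eta {α : Type*} (W : Fin (r + 2) → α) :
    (Fin.cons (W 0) (Fin.snoc (fun k : Fin r => W k.castSucc.succ) (W (Fin.last (r + 1)))) : Fin (r + 2) → α) = W := by
  funext i
  refine Fin.cases ?_ (fun k => ?_) i
  · simp only [Fin.cons_zero]
  · simp only [Fin.cons_succ]
    refine Fin.lastCases ?_ (fun k' => ?_) k
    · simp only [Fin.snoc_last, Fin.succ_last]
    · simp only [Fin.snoc_castSucc]

/-- `x(last) · x(0) · ∏ⱼ x(j.castSucc) x(j.succ) = ∏ⱼ x(j)²` on `Fin (n + 2)`. -/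
theorem prod_castSucc_mul_succ_eq_prod_sq (n : ℕ) (x : Fin (n + 2) → ℝ) :
    x (Fin.last (n + 1)) * x 0 * ∏ j : Fin (n + 1), (x j.castSucc * x j.succ) = ∏ j, x j ^ 2 := by
  rw [Finset.prod_mul_distrib]
  have h1 : ∏ j : Fin (n + 2), x j = (∏ j : Fin (n + 1), x j.castSucc) * x (Fin.last (n + 1)) :=
    Fin.prod_univ_castSucc x
  have h2 : ∏ j : Fin (n + 2), x j = x 0 * ∏ j : Fin (n + 1), x j.succ := Fin.prod_univ_succ x
  have h3 : ∏ j : Fin (n + 2), x j ^ 2 = (∏ j : Fin (n + 2), x j) * ∏ j : Fin (n + 2), x j := by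
    rw [← Finset.prod_mul_distrib]; exact Finset.prod_congr rfl fun j _ => sq (x j)
  rw [h3, congrArg₂ (· * ·) h1 h2]
  ring

/-- `a(W 0)² a(W last)² ∏ₖ a(middle_k)² = ∏ᵢ a(W i)²` on `Fin (r + 2)`. -/
theorem sq_mul_sq_mul_prod_eq {α : Type*} (f : α → ℝ) (W : Fin (r + 2) → α) :
    f (W 0) * f (W (Fin.last (r + 1))) * ∏ k : Fin r, f (W k.castSucc.succ) = ∏ i, f (W i) := by
  rw [Fin.prod_univ_succ, Fin.prod_univ_castSucc]
  simp only [Fin.succ_last]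
  ring

end Index

/-! ### Padding block data to full slice ∕ layer configurations -/

section Pad

variable {P Λ H : Type*} [One H] (M : ℕ) {r : ℕ}

/-- Block slices `Vb : Fin (r+2) → Λ → H` padded by trivial outer slices. -/
def padV (Vb : Fin (r + 2) → Λ → H) : Fin ((M + 3) + (r + 2)) → Λ → H :=
  Fin.append (fun _ => 1) Vb

/-- Block layers `Eb : Fin (r+1) → P → H` padded by trivial layers (outer layers and the seam layer). -/
def padE (Eb : Fin (r + 1) → P → H) : Fin ((M + 3) + (r + 2)) → P → H :=
  Fin.append (fun _ => 1) (Fin.snoc Eb 1 : Fin (r + 2) → P → H)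

/-- Auxiliary `padV_natAdd` of the slice-realisation port (its statement is its type; rôle explained in the module ∕ section docstrings). -/
@[simp] theorem padV_natAdd (Vb : Fin (r + 2) → Λ → H) (i : Fin (r + 2)) :
    padV M Vb (Fin.natAdd (M + 3) i) = Vb i := by
  simp [padV]

/-- Auxiliary `padE_natAdd_castSucc` of the slice-realisation port (its statement is its type; rôle explained in the module ∕ section docstrings). -/
@[simp] theorem padE_natAdd_castSucc (Eb : Fin (r + 1) → P → H) (b : Fin (r + 1)) :
    padE (P := P) M Eb (Fin.natAdd (M + 3) (Fin.castSucc b)) = Eb b := by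
  simp [padE]

variable [MeasurableSpace H]

/-- Auxiliary `measurable_padV` of the slice-realisation port (its statement is its type; rôle explained in the module ∕ section docstrings). -/
theorem measurable_padV :
    Measurable (padV (Λ := Λ) (H := H) M : (Fin (r + 2) → Λ → H) → _) := by
  refine measurable_pi_iff.2 fun t => ?_
  refine Fin.addCases (fun j => ?_) (fun i => ?_) t
  · simp only [padV, Fin.append_left]; exact measurable_const
  · simp only [padV, Fin.append_right]; exact measurable_pi_apply i

/-- Auxiliary `measurable_padE` of the slice-realisation port (its statement is its type; rôle explained in the module ∕ section docstrings). -/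
theorem measurable_padE :
    Measurable (padE (P := P) (H := H) M : (Fin (r + 1) → P → H) → _) := by
  refine measurable_pi_iff.2 fun t => ?_
  refine Fin.addCases (fun j => ?_) (fun i => ?_) t
  · simp only [padE, Fin.append_left]; exact measurable_const
  · simp only [padE, Fin.append_right]
    refine Fin.lastCases ?_ (fun b => ?_) i
    · simp only [Fin.snoc_last]; exact measurable_const
    · simp only [Fin.snoc_castSucc]; exact measurable_pi_apply b

end Pad


/-! ### The splitting `Fin (n + r) → Y ≃ (Fin n → Y) × (Fin r → Y)` (the tree's, named) -/

section Split

/-- The measurable splitting of a configuration on `Fin (n + r)` into its first `n` and last `r` coordinates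
(`Literature.Analysis.OperatorTheory.measurePreserving_finSplit`, named). -/
def finSplit (Y : Type*) [MeasurableSpace Y] (n r : ℕ) : (Fin (n + r) → Y) ≃ᵐ (Fin n → Y) × (Fin r → Y) :=
  (MeasurableEquiv.piCongrLeft (fun _ : Fin (n + r) => Y) finSumFinEquiv).symm.trans
    (MeasurableEquiv.sumPiEquivProdPi fun _ : Fin n ⊕ Fin r => Y)

/-- Auxiliary `measurePreserving_finSplit'` of the slice-realisation port (its statement is its type; rôle explained in the module ∕ section docstrings). -/
theorem measurePreserving_finSplit' {Y : Type*} [MeasurableSpace Y] (ρ : Measure Y) [IsFiniteMeasure ρ]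
    (n r : ℕ) : MeasurePreserving (finSplit Y n r) (Measure.pi fun _ => ρ)
      ((Measure.pi fun _ : Fin n => ρ).prod (Measure.pi fun _ : Fin r => ρ)) :=
  measurePreserving_finSplit n r

/-- Auxiliary `finSplit_fst` of the slice-realisation port (its statement is its type; rôle explained in the module ∕ section docstrings). -/
theorem finSplit_fst {Y : Type*} [MeasurableSpace Y] (n r : ℕ) (V : Fin (n + r) → Y) :
    (finSplit Y n r V).1 = fun t => V (Fin.castAdd r t) := rfl

/-- Auxiliary `finSplit_snd` of the slice-realisation port (its statement is its type; rôle explained in the module ∕ section docstrings). -/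
theorem finSplit_snd {Y : Type*} [MeasurableSpace Y] (n r : ℕ) (V : Fin (n + r) → Y) :
    (finSplit Y n r V).2 = fun j => V (Fin.natAdd n j) := rfl

end Split

/-! ### The block kernel of a windowed species and the block contraction -/

section Block

variable {P Λ H : Type*} [Fintype P] [Fintype Λ] [Group H] [TopologicalSpace H] [IsTopologicalGroup H]
  [CompactSpace H] [MeasurableSpace H] [BorelSpace H] (src tgt : Λ → P) (w : H → ℝ) (a : (Λ → H) → ℝ)

/-- **The block kernel** `Bk(u, v)` of a species factor `F` living in the block of `r + 2` consecutive slices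
`u, x₁, …, x_r, v` (and the `r + 1` temporal layers between them): `a u · (∫ F · slab weight d(x, layers)) · a v`. -/
def blockKernel (M r : ℕ)
    (F : (Fin ((M + 3) + (r + 2)) → Λ → H) × (Fin ((M + 3) + (r + 2)) → P → H) → ℝ) (u v : Λ → H) : ℝ :=
  a u * (∫ q : (Fin r → Λ → H) × (Fin (r + 1) → P → H),
      F (padV M (Fin.cons u (Fin.snoc q.1 v)), padE M q.2) *
        ((∏ i, a (q.1 i) ^ 2) * ∏ b : Fin (r + 1), tempKernel src tgt w
          ((Fin.cons u (Fin.snoc q.1 v) : Fin (r + 2) → Λ → H) (Fin.castSucc b)) (q.2 b)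
          ((Fin.cons u (Fin.snoc q.1 v) : Fin (r + 2) → Λ → H) (Fin.succ b)))
    ∂((Measure.pi fun _ => Measure.pi fun _ : Λ => haarProbability H).prod
        (Measure.pi fun _ => Measure.pi fun _ : P => haarProbability H))) * a v

omit [Fintype P] [Fintype Λ] [Group H] [TopologicalSpace H] [IsTopologicalGroup H] [CompactSpace H]
  [BorelSpace H] in
/-- Joint measurability of the chain `(u, v, x) ↦ u ∷ x :: v`. -/
theorem measurable_consSnoc (r : ℕ) :
    Measurable fun p : ((Λ → H) × (Λ → H)) × (Fin r → Λ → H) =>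
      (Fin.cons p.1.1 (Fin.snoc p.2 p.1.2) : Fin (r + 2) → Λ → H) := by
  refine measurable_pi_iff.mpr fun j => ?_
  refine Fin.cases ?_ (fun k => ?_) j
  · simp only [Fin.cons_zero]; exact measurable_fst.comp measurable_fst
  · simp only [Fin.cons_succ]
    refine Fin.lastCases ?_ (fun i => ?_) k
    · simp only [Fin.snoc_last]; exact measurable_snd.comp measurable_fst
    · simp only [Fin.snoc_castSucc]; exact (measurable_pi_apply i).comp measurable_snd

variable [SecondCountableTopology H]

omit [CompactSpace H] in
set_option maxHeartbeats 400000 in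
/-- The slab weight `(∏ᵢ a(xᵢ)²) · ∏_b tempKernel (chain b) (layer b) (chain (b+1))` is jointly measurable in
`((u, v), (x, layers))`. -/
theorem measurable_slabWeight (hw : Continuous w) (ha : Measurable a) (r : ℕ) :
    Measurable fun p : ((Λ → H) × (Λ → H)) × ((Fin r → Λ → H) × (Fin (r + 1) → P → H)) =>
      (∏ i, a (p.2.1 i) ^ 2) * ∏ b : Fin (r + 1), tempKernel src tgt w
        ((Fin.cons p.1.1 (Fin.snoc p.2.1 p.1.2) : Fin (r + 2) → Λ → H) (Fin.castSucc b)) (p.2.2 b)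
        ((Fin.cons p.1.1 (Fin.snoc p.2.1 p.1.2) : Fin (r + 2) → Λ → H) (Fin.succ b)) := by
  have hch : Measurable fun p : ((Λ → H) × (Λ → H)) × ((Fin r → Λ → H) × (Fin (r + 1) → P → H)) =>
      (Fin.cons p.1.1 (Fin.snoc p.2.1 p.1.2) : Fin (r + 2) → Λ → H) :=
    (measurable_consSnoc r).comp (measurable_fst.prodMk (measurable_fst.comp measurable_snd))
  have hchj : ∀ j : Fin (r + 2),
      Measurable fun p : ((Λ → H) × (Λ → H)) × ((Fin r → Λ → H) × (Fin (r + 1) → P → H)) =>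
        (Fin.cons p.1.1 (Fin.snoc p.2.1 p.1.2) : Fin (r + 2) → Λ → H) j := fun j => (measurable_pi_apply j).comp hch
  have hq1 : ∀ i : Fin r,
      Measurable fun p : ((Λ → H) × (Λ → H)) × ((Fin r → Λ → H) × (Fin (r + 1) → P → H)) => p.2.1 i :=
    fun i => (measurable_pi_apply i).comp (measurable_fst.comp measurable_snd)
  have hq2 : ∀ b : Fin (r + 1),
      Measurable fun p : ((Λ → H) × (Λ → H)) × ((Fin r → Λ → H) × (Fin (r + 1) → P → H)) => p.2.2 b :=
    fun b => (measurable_pi_apply b).comp (measurable_snd.comp measurable_snd)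
  exact (Finset.measurable_prod _ fun i _ => (ha.comp (hq1 i)).pow_const 2).mul
    (Finset.measurable_prod _ fun b _ => (continuous_tempKernel src tgt w hw).measurable.comp
      ((hchj (Fin.castSucc b)).prodMk ((hq2 b).prodMk (hchj (Fin.succ b)))))

omit [Fintype P] [TopologicalSpace H] [IsTopologicalGroup H] [CompactSpace H] [MeasurableSpace H] [BorelSpace H]
  [SecondCountableTopology H] in
/-- Auxiliary `slabWeight_nonneg` of the slice-realisation port (its statement is its type; rôle explained in the module ∕ section docstrings). -/
theorem slabWeight_nonneg (hw0 : ∀ h, 0 ≤ w h) {r : ℕ}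
    (p : ((Λ → H) × (Λ → H)) × ((Fin r → Λ → H) × (Fin (r + 1) → P → H))) :
    0 ≤ (∏ i, a (p.2.1 i) ^ 2) * ∏ b : Fin (r + 1), tempKernel src tgt w
        ((Fin.cons p.1.1 (Fin.snoc p.2.1 p.1.2) : Fin (r + 2) → Λ → H) (Fin.castSucc b)) (p.2.2 b)
        ((Fin.cons p.1.1 (Fin.snoc p.2.1 p.1.2) : Fin (r + 2) → Λ → H) (Fin.succ b)) :=
  mul_nonneg (Finset.prod_nonneg fun _ _ => sq_nonneg _)
    (Finset.prod_nonneg fun _ _ => tempKernel_nonneg src tgt w hw0 _ _ _)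

omit [Fintype P] [TopologicalSpace H] [IsTopologicalGroup H] [CompactSpace H] [MeasurableSpace H] [BorelSpace H]
  [SecondCountableTopology H] in
/-- Auxiliary `slabWeight_le` of the slice-realisation port (its statement is its type; rôle explained in the module ∕ section docstrings). -/
theorem slabWeight_le (hw0 : ∀ h, 0 ≤ w h) {Cw : ℝ} (hwC : ∀ h, w h ≤ Cw) {Ca : ℝ} (haC : ∀ V, |a V| ≤ Ca)
    {r : ℕ} (p : ((Λ → H) × (Λ → H)) × ((Fin r → Λ → H) × (Fin (r + 1) → P → H))) :
    (∏ i, a (p.2.1 i) ^ 2) * ∏ b : Fin (r + 1), tempKernel src tgt w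
        ((Fin.cons p.1.1 (Fin.snoc p.2.1 p.1.2) : Fin (r + 2) → Λ → H) (Fin.castSucc b)) (p.2.2 b)
        ((Fin.cons p.1.1 (Fin.snoc p.2.1 p.1.2) : Fin (r + 2) → Λ → H) (Fin.succ b)) ≤
      (Ca ^ 2) ^ r * (Cw ^ Fintype.card Λ) ^ (r + 1) := by
  have hCw : 0 ≤ Cw ^ Fintype.card Λ :=
    (tempKernel_nonneg src tgt w hw0 1 1 1).trans (tempKernel_le_pow src tgt w hw0 hwC 1 1 1)
  refine mul_le_mul ?_ ?_ (Finset.prod_nonneg fun _ _ => tempKernel_nonneg src tgt w hw0 _ _ _)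
    (pow_nonneg (sq_nonneg _) _)
  · calc ∏ i, a (p.2.1 i) ^ 2 ≤ ∏ _i : Fin r, Ca ^ 2 :=
          Finset.prod_le_prod (fun _ _ => sq_nonneg _) fun i _ => by
            rw [← abs_sq, abs_pow]; exact pow_le_pow_left₀ (abs_nonneg _) (haC _) 2
      _ = (Ca ^ 2) ^ r := by rw [Finset.prod_const, Finset.card_univ, Fintype.card_fin]
  · calc ∏ b : Fin (r + 1), tempKernel src tgt w
            ((Fin.cons p.1.1 (Fin.snoc p.2.1 p.1.2) : Fin (r + 2) → Λ → H) (Fin.castSucc b)) (p.2.2 b)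
            ((Fin.cons p.1.1 (Fin.snoc p.2.1 p.1.2) : Fin (r + 2) → Λ → H) (Fin.succ b))
          ≤ ∏ _b : Fin (r + 1), Cw ^ Fintype.card Λ :=
          Finset.prod_le_prod (fun _ _ => tempKernel_nonneg src tgt w hw0 _ _ _) fun b _ =>
            tempKernel_le_pow src tgt w hw0 hwC _ _ _
      _ = (Cw ^ Fintype.card Λ) ^ (r + 1) := by rw [Finset.prod_const, Finset.card_univ, Fintype.card_fin]

omit [CompactSpace H] in
/-- The block integrand `F(pad(u ∷ x :: v), pad(layers)) · slab weight` is jointly measurable. -/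
theorem measurable_blockIntegrand (hw : Continuous w) (ha : Measurable a) (M r : ℕ)
    {F : (Fin ((M + 3) + (r + 2)) → Λ → H) × (Fin ((M + 3) + (r + 2)) → P → H) → ℝ} (hFm : Measurable F) :
    Measurable fun p : ((Λ → H) × (Λ → H)) × ((Fin r → Λ → H) × (Fin (r + 1) → P → H)) =>
      F (padV M (Fin.cons p.1.1 (Fin.snoc p.2.1 p.1.2)), padE M p.2.2) *
        ((∏ i, a (p.2.1 i) ^ 2) * ∏ b : Fin (r + 1), tempKernel src tgt w
          ((Fin.cons p.1.1 (Fin.snoc p.2.1 p.1.2) : Fin (r + 2) → Λ → H) (Fin.castSucc b)) (p.2.2 b)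
          ((Fin.cons p.1.1 (Fin.snoc p.2.1 p.1.2) : Fin (r + 2) → Λ → H) (Fin.succ b))) := by
  have hch : Measurable fun p : ((Λ → H) × (Λ → H)) × ((Fin r → Λ → H) × (Fin (r + 1) → P → H)) =>
      (Fin.cons p.1.1 (Fin.snoc p.2.1 p.1.2) : Fin (r + 2) → Λ → H) :=
    (measurable_consSnoc r).comp (measurable_fst.prodMk (measurable_fst.comp measurable_snd))
  exact (hFm.comp (((measurable_padV M).comp hch).prodMk
    ((measurable_padE M).comp (measurable_snd.comp measurable_snd)))).mul (measurable_slabWeight src tgt w a hw ha r)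

omit [Fintype P] [TopologicalSpace H] [IsTopologicalGroup H] [CompactSpace H] [MeasurableSpace H] [BorelSpace H]
  [SecondCountableTopology H] in
/-- Auxiliary `norm_blockIntegrand_le` of the slice-realisation port (its statement is its type; rôle explained in the module ∕ section docstrings). -/
theorem norm_blockIntegrand_le (hw0 : ∀ h, 0 ≤ w h) {Cw : ℝ} (hwC : ∀ h, w h ≤ Cw) {Ca : ℝ}
    (haC : ∀ V, |a V| ≤ Ca) (M r : ℕ)
    {F : (Fin ((M + 3) + (r + 2)) → Λ → H) × (Fin ((M + 3) + (r + 2)) → P → H) → ℝ} {nrm : ℝ}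
    (hFb : ∀ q, |F q| ≤ nrm) (p : ((Λ → H) × (Λ → H)) × ((Fin r → Λ → H) × (Fin (r + 1) → P → H))) :
    ‖F (padV M (Fin.cons p.1.1 (Fin.snoc p.2.1 p.1.2)), padE M p.2.2) *
        ((∏ i, a (p.2.1 i) ^ 2) * ∏ b : Fin (r + 1), tempKernel src tgt w
          ((Fin.cons p.1.1 (Fin.snoc p.2.1 p.1.2) : Fin (r + 2) → Λ → H) (Fin.castSucc b)) (p.2.2 b)
          ((Fin.cons p.1.1 (Fin.snoc p.2.1 p.1.2) : Fin (r + 2) → Λ → H) (Fin.succ b)))‖ ≤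
      nrm * ((Ca ^ 2) ^ r * (Cw ^ Fintype.card Λ) ^ (r + 1)) := by
  rw [norm_mul, Real.norm_eq_abs, Real.norm_eq_abs, abs_of_nonneg (slabWeight_nonneg src tgt w a hw0 p)]
  exact mul_le_mul (hFb _) (slabWeight_le src tgt w a hw0 hwC haC p) (slabWeight_nonneg src tgt w a hw0 p)
    ((abs_nonneg _).trans (hFb (padV M (Fin.cons p.1.1 (Fin.snoc p.2.1 p.1.2)), padE M p.2.2)))

/-- The block kernel is jointly strongly measurable. -/
theorem stronglyMeasurable_uncurry_blockKernel (hw : Continuous w) (ha : Measurable a) (M r : ℕ)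
    {F : (Fin ((M + 3) + (r + 2)) → Λ → H) × (Fin ((M + 3) + (r + 2)) → P → H) → ℝ} (hFm : Measurable F) :
    StronglyMeasurable (uncurry (blockKernel src tgt w a M r F)) := by
  have hI := (measurable_blockIntegrand src tgt w a hw ha M r hFm).stronglyMeasurable.integral_prod_right'
    (ν := (Measure.pi fun _ => Measure.pi fun _ : Λ => haarProbability H).prod
      (Measure.pi fun _ => Measure.pi fun _ : P => haarProbability H))
  have h1 : StronglyMeasurable fun p : (Λ → H) × (Λ → H) => a p.1 := (ha.comp measurable_fst).stronglyMeasurable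
  have h2 : StronglyMeasurable fun p : (Λ → H) × (Λ → H) => a p.2 := (ha.comp measurable_snd).stronglyMeasurable
  exact (h1.mul hI).mul h2

omit [SecondCountableTopology H] in
/-- A uniform bound of the block kernel. -/
theorem norm_blockKernel_le (hw0 : ∀ h, 0 ≤ w h) {Cw : ℝ} (hwC : ∀ h, w h ≤ Cw) {Ca : ℝ}
    (haC : ∀ V, |a V| ≤ Ca) (M r : ℕ)
    {F : (Fin ((M + 3) + (r + 2)) → Λ → H) × (Fin ((M + 3) + (r + 2)) → P → H) → ℝ} {nrm : ℝ}
    (hFb : ∀ q, |F q| ≤ nrm) (u v : Λ → H) :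
    ‖blockKernel src tgt w a M r F u v‖ ≤ Ca * (nrm * ((Ca ^ 2) ^ r * (Cw ^ Fintype.card Λ) ^ (r + 1))) * Ca := by
  have ha0 : 0 ≤ Ca := (abs_nonneg _).trans (haC u)
  have hI := norm_integral_le_of_norm_le_const (Eventually.of_forall fun q =>
    norm_blockIntegrand_le src tgt w a hw0 hwC haC M r hFb ((u, v), q))
    (μ := (Measure.pi fun _ => Measure.pi fun _ : Λ => haarProbability H).prod
      (Measure.pi fun _ => Measure.pi fun _ : P => haarProbability H))
  rw [probReal_univ, mul_one] at hI
  unfold blockKernel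
  rw [norm_mul, norm_mul, Real.norm_eq_abs (a u), Real.norm_eq_abs (a v)]
  exact mul_le_mul (mul_le_mul (haC u) hI (norm_nonneg _) ha0) (haC v) (abs_nonneg _)
    (mul_nonneg ha0 ((norm_nonneg _).trans hI))

/-- **Path-kernel domination of the block kernel**: `|Bk(u, v)| ≤ nrm · pathK μ K r u v` for `|F| ≤ nrm` and
`0 ≤ a` (§6 `integral_slab_eq_integral_pathChain` + `abs_mul_integral_mul_mul_le`). -/
theorem abs_blockKernel_le_pathK (hw : Continuous w) (hw0 : ∀ h, 0 ≤ w h) {Cw : ℝ} (hwC : ∀ h, w h ≤ Cw)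
    (ha : Measurable a) {Ca : ℝ} (haC : ∀ V, |a V| ≤ Ca) (ha0 : ∀ V, 0 ≤ a V) (M r : ℕ)
    {F : (Fin ((M + 3) + (r + 2)) → Λ → H) × (Fin ((M + 3) + (r + 2)) → P → H) → ℝ} (hFm : Measurable F)
    {nrm : ℝ} (hFb : ∀ q, |F q| ≤ nrm) (u v : Λ → H) :
    |blockKernel src tgt w a M r F u v| ≤
      nrm * pathK (Measure.pi fun _ : Λ => haarProbability H) (sandKernel src tgt w a) r u v := by
  unfold blockKernel pathK
  rw [← integral_slab_eq_integral_pathChain src tgt w a hw hw0 hwC ha haC r u v]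
  have hGm := (measurable_slabWeight src tgt w a hw ha r).comp
    (measurable_const.prodMk measurable_id : Measurable fun q : (Fin r → Λ → H) × (Fin (r + 1) → P → H) =>
      (((u, v) : (Λ → H) × (Λ → H)), q))
  have hFGm := (measurable_blockIntegrand src tgt w a hw ha M r hFm).comp
    (measurable_const.prodMk measurable_id : Measurable fun q : (Fin r → Λ → H) × (Fin (r + 1) → P → H) =>
      (((u, v) : (Λ → H) × (Λ → H)), q))
  refine abs_mul_integral_mul_mul_le _ (ha0 u) (ha0 v) (fun q => slabWeight_nonneg src tgt w a hw0 ((u, v), q))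
    (fun q => hFb _) ?_ ?_
  · refine (integrable_const ((Ca ^ 2) ^ r * (Cw ^ Fintype.card Λ) ^ (r + 1))).mono'
      hGm.aestronglyMeasurable (Eventually.of_forall fun q => ?_)
    rw [Real.norm_eq_abs, abs_of_nonneg (slabWeight_nonneg src tgt w a hw0 ((u, v), q))]
    exact slabWeight_le src tgt w a hw0 hwC haC ((u, v), q)
  · exact (integrable_const _).mono' hFGm.aestronglyMeasurable
      (Eventually.of_forall fun q => norm_blockIntegrand_le src tgt w a hw0 hwC haC M r hFb ((u, v), q))


end Block

end Summit.QuantumFields.YangMills.Cruxes.IRcof.EquipartitionSeam.SliceKernel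

end
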